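import Mathlib

/-!
# Affine kill lemma (sub-goal `caseII_affineKill` of `stub_caseII`, line `eac-extends-core-automorphisms`,
crux stmt-Schanuel-0968 `Summit.Schanuel.Schanuel.Theses.RigidCore.AclSubsetLogFreeCore`)

Pure algebra used at an `L`-step of Case II of "core-fixed elements of the ELA-core are log-free": for subfields
`L ≤ R` of a field `E` of characteristic zero, `y ∈ R` transcendental over `L`, `x ∈ R` algebraic over `L(y)`, and
an infinite family of ring homomorphisms `σ j : R → E` mapping `L` into `L` with finitely many images of each element
of `L`, fixing `x` and moving `y` affinely over `L` in pairwise distinct ways, `x` is algebraic over `L`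
(`caseII_affineKill`). Proof: the minimal polynomial `μ` of `x` over `K = L(y)` is invariant under every `σ j`
(which maps `K` into `K` and fixes `x`), so each coefficient `c = p(y)/q(y)` (`p, q ∈ L[X]` coprime) of `μ` is
`σ j`-fixed; by pigeonhole infinitely many `j` twist the coefficients of `p, q` in the same way, and then `p̃/q̃` is
invariant under infinitely many pairwise distinct affine substitutions, hence constant by the elementary rigidity
statement `affKill_exists_C_mul_of_affine_invariant` (eigenvectors of `X ↦ X + δ` are constant; the translation part
of an affine symmetry of a non-constant polynomial is determined by its linear part; eigenvectors of `X ↦ α X` for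
`α` of large multiplicative order are monomials). So `c ∈ L`, i.e. `μ ∈ L[X]`. Mathlib only; no named facts.
-/

noncomputable section

set_option linter.dupNamespace false -- `Summit.Schanuel.Schanuel.…` is the D-0017 single-problem layout

open Polynomial

namespace Summit.Schanuel.Schanuel.Theorems.RigidCore

/-- A polynomial over a field of characteristic zero which is invariant under a non-trivial translation
`X ↦ X + δ` is constant. -/
theorem affKill_natDegree_eq_zero_of_comp_X_add_C {L : Type*} [Field L] [CharZero L] (p : L[X]) {δ : L}
    (hδ : δ ≠ 0) (h : p.comp (X + C δ) = p) : p.natDegree = 0 := by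
  have key : ∀ n : ℕ, p.eval ((n : L) * δ) = p.eval 0 := by
    intro n
    induction n with
    | zero => simp
    | succ n ih =>
      have h1 := congrArg (eval ((n : L) * δ)) h
      rw [eval_comp, eval_add, eval_X, eval_C] at h1
      rw [← ih, ← h1]; congr 1; push_cast; ring
  have hroots : (p - C (p.eval 0)) = 0 := by
    apply eq_zero_of_infinite_isRoot
    have hsub : Set.range (fun n : ℕ => (n : L) * δ) ⊆ {x | IsRoot (p - C (p.eval 0)) x} := by
      rintro _ ⟨n, rfl⟩
      simp [IsRoot, key n]
    refine Set.Infinite.mono hsub (Set.infinite_range_of_injective fun m n hmn => ?_)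
    exact_mod_cast mul_right_cancel₀ hδ hmn
  rw [sub_eq_zero.mp hroots, natDegree_C]

/-- If a non-constant polynomial is an eigenvector of the two affine substitutions `X ↦ α X + β₁` and
`X ↦ α X + β₂` (`α ≠ 0`), then `β₁ = β₂`. -/
theorem affKill_shift_unique {L : Type*} [Field L] [CharZero L] (p : L[X]) (hp : p.natDegree ≠ 0)
    {α β₁ β₂ c₁ c₂ : L} (hα : α ≠ 0) (h₁ : p.comp (C α * X + C β₁) = C c₁ * p)
    (h₂ : p.comp (C α * X + C β₂) = C c₂ * p) : β₁ = β₂ := by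
  have hp0 : p ≠ 0 := by rintro rfl; exact hp natDegree_zero
  set gi : L[X] := C α⁻¹ * (X - C β₂) with hgi
  have e₂ : (C α * X + C β₂).comp gi = X := by
    simp only [hgi, add_comp, mul_comp, C_comp, X_comp, ← mul_assoc, ← C_mul, mul_inv_cancel₀ hα, C_1, one_mul,
      sub_add_cancel]
  have e₁ : (C α * X + C β₁).comp gi = X + C (β₁ - β₂) := by
    simp only [hgi, add_comp, mul_comp, C_comp, X_comp, ← mul_assoc, ← C_mul, mul_inv_cancel₀ hα, C_1, one_mul,
      map_sub]
    ring
  have h₂' : p = C c₂ * p.comp gi := by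
    conv_lhs => rw [← comp_X (p := p), ← e₂, ← comp_assoc, h₂, C_mul_comp]
  have hc₂ : c₂ ≠ 0 := by rintro rfl; rw [C_0, zero_mul] at h₂'; exact hp0 h₂'
  have h₁' : p.comp (X + C (β₁ - β₂)) = C (c₁ * c₂⁻¹) * p := by
    rw [← e₁, ← comp_assoc, h₁, C_mul_comp]
    conv_rhs => rw [h₂']
    rw [← mul_assoc, ← C_mul, mul_assoc, inv_mul_cancel₀ hc₂, mul_one]
  -- compare leading coefficients: the eigenvalue of a translation is `1`
  have hlc := congrArg leadingCoeff h₁'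
  rw [leadingCoeff_comp (by rw [natDegree_X_add_C]; exact one_ne_zero), leadingCoeff_X_add_C, one_pow, mul_one,
    leadingCoeff_mul, leadingCoeff_C, eq_comm, mul_eq_right₀ (leadingCoeff_ne_zero.mpr hp0)] at hlc
  rw [hlc, C_1, one_mul] at h₁'
  exact Classical.byContradiction fun hne => hp (affKill_natDegree_eq_zero_of_comp_X_add_C p (sub_ne_zero.mpr hne) h₁')

/-- Exponents `≤ N` of a nonzero `α` which is not a root of unity of order `≤ N` are determined by the power `α ^ n`. -/
theorem affKill_pow_inj {L : Type*} [Field L] {α : L} {N : ℕ} (hα : α ≠ 0) (hgood : ∀ k, 0 < k → k ≤ N → α ^ k ≠ 1)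
    {m n : ℕ} (hm : m ≤ N) (hn : n ≤ N) (h : α ^ m = α ^ n) : m = n := by
  by_contra hne
  wlog hlt : m < n generalizing m n
  · exact this hn hm h.symm (Ne.symm hne) (lt_of_le_of_ne (not_lt.mp hlt) (Ne.symm hne))
  refine hgood (n - m) (Nat.sub_pos_of_lt hlt) (by omega) (mul_left_cancel₀ (pow_ne_zero m hα) ?_)
  rw [← pow_add, Nat.add_sub_cancel' hlt.le, mul_one, h]

/-- A nonzero polynomial which is an eigenvector of `X ↦ α X`, for `α ≠ 0` not a root of unity of order
`≤ N` (`N ≥` its degree), is a monomial, with eigenvalue `α ^ natDegree`. -/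
theorem affKill_eq_monomial {L : Type*} [Field L] (p : L[X]) (hp : p ≠ 0) {α c : L} {N : ℕ} (hα : α ≠ 0)
    (hgood : ∀ k, 0 < k → k ≤ N → α ^ k ≠ 1) (hN : p.natDegree ≤ N) (h : p.comp (C α * X) = C c * p) :
    c = α ^ p.natDegree ∧ p = C p.leadingCoeff * X ^ p.natDegree := by
  have hcoeff : ∀ k, p.coeff k * α ^ k = c * p.coeff k := fun k => by rw [← coeff_C_mul, ← h, comp_C_mul_X_coeff]
  have hc : c = α ^ p.natDegree :=
    (mul_right_cancel₀ (leadingCoeff_ne_zero.mpr hp) ((mul_comm _ _).trans (hcoeff p.natDegree))).symm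
  refine ⟨hc, Polynomial.ext fun k => ?_⟩
  rw [coeff_C_mul_X_pow]
  split_ifs with hk
  · rw [hk]; rfl
  · rcases lt_or_gt_of_ne hk with hk' | hk'
    · by_contra hne
      have h1 := hcoeff k
      rw [hc, mul_comm, mul_eq_mul_right_iff] at h1
      exact h1.elim (fun h1 => hk (affKill_pow_inj hα hgood (by omega) hN h1)) hne
    · exact coeff_eq_zero_of_natDegree_lt hk'

/-- Conjugating the affine substitution `X ↦ α X + β` with fixed point `y₁` by the translation `X ↦ X + y₁`
gives the linear substitution `X ↦ α X`. -/
theorem affKill_taylor_comp {L : Type*} [CommRing L] (r : L[X]) {α β y₁ : L} (hfix : α * y₁ + β = y₁) :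
    taylor y₁ (r.comp (C α * X + C β)) = (taylor y₁ r).comp (C α * X) := by
  simp only [taylor_apply, comp_assoc, add_comp, mul_comp, C_comp, X_comp]
  congr 1
  rw [mul_add, ← C_mul, add_assoc, ← C_add, hfix]

/-- The roots of unity of order `≤ N` in a field form a finite set. -/
theorem affKill_finite_rootsOfUnity_le (L : Type*) [Field L] (N : ℕ) :
    {α : L | ∃ k, 0 < k ∧ k ≤ N ∧ α ^ k = 1}.Finite := by
  have hsub : {α : L | ∃ k, 0 < k ∧ k ≤ N ∧ α ^ k = 1} ⊆ ⋃ k ∈ Finset.Icc 1 N, {α : L | IsRoot (X ^ k - 1) α} := by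
    rintro α ⟨k, hk0, hkN, hk⟩
    simp only [Set.mem_iUnion, Finset.mem_Icc, Set.mem_setOf_eq, IsRoot, eval_sub, eval_pow, eval_X, eval_one]
    exact ⟨k, ⟨hk0, hkN⟩, by rw [hk, sub_self]⟩
  refine Set.Finite.subset (Set.Finite.biUnion (Finset.finite_toSet _) fun k hk => ?_) hsub
  apply finite_setOf_isRoot
  rw [← C_1]
  exact X_pow_sub_C_ne_zero (Finset.mem_Icc.mp hk).1 1

/-- A nonzero polynomial dividing its own image under a substitution of degree `1` is an eigenvector of that
substitution. -/
theorem affKill_exists_comp_eq_C_mul {L : Type*} [Field L] {q G : L[X]} (hq : q ≠ 0) (hG : G.natDegree = 1)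
    (hdvd : q ∣ q.comp G) : ∃ c : L, q.comp G = C c * q := by
  obtain ⟨r, hr⟩ := hdvd
  have hG0 : G ≠ 0 := by rintro rfl; simp at hG
  have hqG : q.comp G ≠ 0 := by
    intro h0
    have h1 := congrArg leadingCoeff h0
    rw [leadingCoeff_comp (by rw [hG]; exact one_ne_zero), leadingCoeff_zero] at h1
    exact mul_ne_zero (leadingCoeff_ne_zero.mpr hq) (pow_ne_zero _ (leadingCoeff_ne_zero.mpr hG0)) h1
  have hr0 : r ≠ 0 := by rintro rfl; rw [mul_zero] at hr; exact hqG hr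
  have hdeg : r.natDegree = 0 := by
    have h1 := congrArg natDegree hr
    rw [natDegree_comp, hG, mul_one, natDegree_mul hq hr0] at h1
    omega
  rw [eq_C_of_natDegree_eq_zero hdeg] at hr
  exact ⟨r.coeff 0, by rw [hr, mul_comm]⟩

/-- **Affine rigidity of rational functions.** Let `p, q` be coprime polynomials over a field of characteristic
zero, `q ≠ 0`, such that `p(a_j X + b_j) · q(X) = q(a_j X + b_j) · p(X)` (i.e. `p / q` is invariant under the affine
substitution `X ↦ a_j X + b_j`, `a_j ≠ 0`) for all `j` in an infinite set `J` on which `j ↦ (a_j, b_j)` is injective.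
Then `p = κ · q` for some `κ`. (Proof: `p` and `q` are eigenvectors of every substitution with the same eigenvalue;
unless both are constant, `b_j` is determined by `a_j` (`affKill_shift_unique`), so some `a_j` is not a root of unity
of order `≤ deg p + deg q`, and conjugating its substitution to `X ↦ a X` (`affKill_taylor_comp`) makes `p` and `q`
proportional monomials (`affKill_eq_monomial`).) -/
theorem affKill_exists_C_mul_of_affine_invariant {L : Type*} [Field L] [CharZero L] {p q : L[X]} (hq : q ≠ 0)
    (hcop : IsCoprime p q) {ι : Type*} {J : Set ι} (hJ : J.Infinite) (a b : ι → L) (ha : ∀ j ∈ J, a j ≠ 0)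
    (hinj : Set.InjOn (fun j => (a j, b j)) J)
    (h : ∀ j ∈ J, p.comp (C (a j) * X + C (b j)) * q = q.comp (C (a j) * X + C (b j)) * p) :
    ∃ κ : L, p = C κ * q := by
  by_cases hp : p = 0
  · exact ⟨0, by rw [hp, C_0, zero_mul]⟩
  have hG : ∀ j ∈ J, (C (a j) * X + C (b j)).natDegree = 1 := fun j hj => natDegree_linear (ha j hj)
  -- `p` and `q` are eigenvectors of each substitution, with the same eigenvalue
  have hsemi : ∀ j ∈ J, ∃ c : L, p.comp (C (a j) * X + C (b j)) = C c * p ∧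
      q.comp (C (a j) * X + C (b j)) = C c * q := by
    intro j hj
    obtain ⟨c, hc⟩ := affKill_exists_comp_eq_C_mul hp (hG j hj) (hcop.dvd_of_dvd_mul_right ⟨_, by rw [h j hj, mul_comm]⟩)
    obtain ⟨c', hc'⟩ :=
      affKill_exists_comp_eq_C_mul hq (hG j hj) (hcop.symm.dvd_of_dvd_mul_right ⟨_, by rw [← h j hj, mul_comm]⟩)
    refine ⟨c, hc, ?_⟩
    have key := h j hj
    rw [hc, hc'] at key
    have key' : C (c' - c) * (p * q) = 0 := by rw [map_sub]; linear_combination -key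
    rw [mul_eq_zero, C_eq_zero, sub_eq_zero] at key'
    rcases key' with rfl | key'
    · exact hc'
    · exact absurd key' (mul_ne_zero hp hq)
  -- the degenerate case: `p` and `q` both constant
  by_cases hdeg : p.natDegree = 0 ∧ q.natDegree = 0
  · refine ⟨p.coeff 0 / q.coeff 0, ?_⟩
    have hq0 : q.coeff 0 ≠ 0 := fun h0 => hq (by rw [eq_C_of_natDegree_eq_zero hdeg.2, h0, C_0])
    calc p = C (p.coeff 0) := eq_C_of_natDegree_eq_zero hdeg.1
      _ = C (p.coeff 0 / q.coeff 0) * C (q.coeff 0) := by rw [← C_mul, div_mul_cancel₀ _ hq0]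
      _ = _ := by rw [← eq_C_of_natDegree_eq_zero hdeg.2]
  have hNpos : 0 < p.natDegree + q.natDegree := by rcases not_and_or.mp hdeg with h0 | h0 <;> omega
  -- otherwise `b j` is determined by `a j`, so infinitely many distinct `a j` occur
  have hainj : Set.InjOn a J := by
    intro j hj j' hj' hjj'
    obtain ⟨c, hpc, hqc⟩ := hsemi j hj
    obtain ⟨c', hpc', hqc'⟩ := hsemi j' hj'
    rw [hjj'] at hpc hqc
    have hb : b j = b j' := by
      by_cases hp0 : p.natDegree = 0
      · exact affKill_shift_unique q (fun h0 => hdeg ⟨hp0, h0⟩) (ha j' hj') hqc hqc'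
      · exact affKill_shift_unique p hp0 (ha j' hj') hpc hpc'
    exact hinj hj hj' (Prod.ext hjj' hb)
  obtain ⟨α, ⟨j₁, hj₁, rfl⟩, hgood⟩ :=
    (hJ.image hainj).exists_notMem_finite (affKill_finite_rootsOfUnity_le L (p.natDegree + q.natDegree))
  simp only [Set.mem_setOf_eq, not_exists, not_and] at hgood
  have hα1 : a j₁ ≠ 1 := fun h1 => hgood 1 one_pos hNpos (by rw [h1, one_pow])
  obtain ⟨c, hpc, hqc⟩ := hsemi j₁ hj₁
  -- conjugate to the linear substitution `X ↦ a j₁ • X` by moving the fixed point `y₁` to `0`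
  set y₁ : L := b j₁ / (1 - a j₁) with hy₁
  have hfix : a j₁ * y₁ + b j₁ = y₁ := by
    have h1 : (1 - a j₁) ≠ 0 := sub_ne_zero.mpr (Ne.symm hα1)
    rw [hy₁]
    field_simp
    ring
  have hpt := congrArg (taylor y₁) hpc
  have hqt := congrArg (taylor y₁) hqc
  rw [affKill_taylor_comp p hfix, taylor_mul, taylor_C] at hpt
  rw [affKill_taylor_comp q hfix, taylor_mul, taylor_C] at hqt
  set P := taylor y₁ p with hP
  set Q := taylor y₁ q with hQ
  have hP0 : P ≠ 0 := fun h0 => hp (taylor_injective y₁ (by rw [← hP, h0, map_zero]))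
  have hQ0 : Q ≠ 0 := fun h0 => hq (taylor_injective y₁ (by rw [← hQ, h0, map_zero]))
  have hPdeg : P.natDegree = p.natDegree := natDegree_taylor _ _
  have hQdeg : Q.natDegree = q.natDegree := natDegree_taylor _ _
  obtain ⟨hcP, hPmon⟩ := affKill_eq_monomial P hP0 (ha j₁ hj₁) hgood (by omega) hpt
  obtain ⟨hcQ, hQmon⟩ := affKill_eq_monomial Q hQ0 (ha j₁ hj₁) hgood (by omega) hqt
  -- the degrees agree since the eigenvalues do, so `P` and `Q` are proportional
  have hnm : P.natDegree = Q.natDegree := affKill_pow_inj (ha j₁ hj₁) hgood (by omega) (by omega) (hcP ▸ hcQ)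
  refine ⟨P.leadingCoeff / Q.leadingCoeff, taylor_injective y₁ ?_⟩
  rw [taylor_mul, taylor_C, ← hP, ← hQ]
  calc P = C P.leadingCoeff * X ^ P.natDegree := hPmon
    _ = C (P.leadingCoeff / Q.leadingCoeff) * (C Q.leadingCoeff * X ^ Q.natDegree) := by
        rw [← mul_assoc, ← C_mul, div_mul_cancel₀ _ (leadingCoeff_ne_zero.mpr hQ0), hnm]
    _ = C (P.leadingCoeff / Q.leadingCoeff) * Q := by rw [← hQmon]

/-- If every element `a` of `L` has only finitely many images `γ j a`, then a fixed polynomial `r ∈ L[X]` has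
only finitely many twists `r.map (γ j)`. -/
theorem affKill_finite_range_map {ι L L' : Type*} [Semiring L] [Semiring L'] (r : L[X]) (γ : ι → L →+* L')
    (hγ : ∀ a : L, (Set.range fun j => γ j a).Finite) : (Set.range fun j => r.map (γ j)).Finite := by
  induction r using Polynomial.induction_on' with
  | add p q hp hq =>
    refine ((hp.prod hq).image fun x => x.1 + x.2).subset ?_
    rintro _ ⟨j, rfl⟩
    exact ⟨(p.map (γ j), q.map (γ j)), ⟨⟨j, rfl⟩, ⟨j, rfl⟩⟩, (Polynomial.map_add (γ j)).symm⟩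
  | monomial n a =>
    refine ((hγ a).image (monomial n)).subset ?_
    rintro _ ⟨j, rfl⟩
    exact ⟨γ j a, ⟨j, rfl⟩, (map_monomial _).symm⟩

/-- **Affine kill lemma** (sub-goal `caseII_affineKill` of `stub_caseII`, line `eac-extends-core-automorphisms`, crux
stmt-Schanuel-0968). Let `L ≤ R` be subfields of a field `E` of characteristic zero, `y ∈ R` transcendental over `L`
and `x ∈ R` algebraic over `L(y)`. If an infinite family of ring homomorphisms `σ j : R → E` maps `L` into `L` with
finitely many images of each element of `L`, fixes `x`, and moves `y` affinely, `σ j y = u j * y + v j` with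
`u j ∈ L ∖ {0}`, `v j ∈ L` and `j ↦ (u j, v j)` injective, then `x` is algebraic over `L`. (The minimal polynomial
of `x` over `L(y)` is `σ j`-invariant, so its coefficients `p(y)/q(y)` are `σ j`-fixed; by pigeonhole and
`affKill_exists_C_mul_of_affine_invariant` they lie in `L`.) -/
theorem caseII_affineKill {E : Type*} [Field E] [CharZero E] (L : Subfield E) (R : Subfield E)
    (hLR : L ≤ R) (x y : E) (hxR : x ∈ R) (hyR : y ∈ R)
    (hy : Transcendental L y) (hxy : IsAlgebraic (IntermediateField.adjoin L ({y} : Set E)) x)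
    {ι : Type*} [Infinite ι] (σ : ι → (R →+* E))
    (hσL : ∀ (j : ι) (a : E) (ha : a ∈ L), σ j ⟨a, hLR ha⟩ ∈ L)
    (hfin : ∀ (a : E) (ha : a ∈ L), Set.Finite (Set.range fun j => σ j ⟨a, hLR ha⟩))
    (hx : ∀ j, σ j ⟨x, hxR⟩ = x)
    (u v : ι → E) (hu : ∀ j, u j ∈ L ∧ u j ≠ 0) (hv : ∀ j, v j ∈ L)
    (hσy : ∀ j, σ j ⟨y, hyR⟩ = u j * y + v j)
    (hinj : Function.Injective fun j => (u j, v j)) :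
    IsAlgebraic L x := by
  classical
  set K : IntermediateField L E := IntermediateField.adjoin L ({y} : Set E) with hK
  -- `L ⊆ K ⊆ R`; the restrictions `γ j : L → L` and `φ j : K → K` of `σ j`
  have hLK : ∀ w : E, w ∈ L → w ∈ K := fun w hw => K.algebraMap_mem ⟨w, hw⟩
  have hKR : ∀ z : E, z ∈ K → z ∈ R := fun z hz => (show K ≤ R.toIntermediateField fun a => hLR a.2 by
    rw [hK, IntermediateField.adjoin_le_iff, Set.singleton_subset_iff]; exact hyR) hz
  let γ : ι → (L →+* L) := fun j => ((σ j).comp (Subfield.inclusion hLR)).codRestrict L fun a => hσL j a a.2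
  have hσK : ∀ j (z : E) (hz : z ∈ K), σ j ⟨z, hKR z hz⟩ ∈ K := by
    intro j z hz
    refine IntermediateField.adjoin_induction (F := L) (s := ({y} : Set E)) (p := fun z hz => σ j ⟨z, hKR z hz⟩ ∈ K)
      ?_ (fun a => hLK _ (hσL j a a.2)) ?_ ?_ ?_ hz
    · intro z hz
      obtain rfl := Set.mem_singleton_iff.mp hz
      rw [hσy j]
      exact add_mem (mul_mem (hLK _ (hu j).1) (IntermediateField.subset_adjoin L _ (Set.mem_singleton _))) (hLK _ (hv j))
    · intro z w hz hw ihz ihw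
      rw [show (⟨z + w, hKR _ (add_mem hz hw)⟩ : R) = ⟨z, hKR z hz⟩ + ⟨w, hKR w hw⟩ from rfl, map_add]
      exact add_mem ihz ihw
    · intro z hz ihz
      rw [show (⟨z⁻¹, hKR _ (inv_mem hz)⟩ : R) = (⟨z, hKR z hz⟩ : R)⁻¹ from rfl, map_inv₀]
      exact inv_mem ihz
    · intro z w hz hw ihz ihw
      rw [show (⟨z * w, hKR _ (mul_mem hz hw)⟩ : R) = ⟨z, hKR z hz⟩ * ⟨w, hKR w hw⟩ from rfl, map_mul]
      exact mul_mem ihz ihw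
  let inK : K →+* R := (algebraMap K E).codRestrict R fun z => hKR z z.2
  let φ : ι → (K →+* K) := fun j => ((σ j).comp inK).codRestrict K fun z => hσK j z z.2
  -- the minimal polynomial `μ` of `x` over `K` is `φ j`-invariant
  set μ : K[X] := minpoly K x with hμ
  have hμmo : μ.Monic := minpoly.monic hxy.isIntegral
  have hμx : aeval x μ = 0 := minpoly.aeval K x
  have hμφ : ∀ j, μ.map (φ j) = μ := by
    intro j
    refine minpoly.unique K x (hμmo.map _) ?_ fun r hr hr0 => by rw [degree_map]; exact minpoly.min K x hr hr0
    have h0 : μ.eval₂ inK ⟨x, hxR⟩ = 0 := by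
      apply R.subtype_injective
      rw [hom_eval₂, show R.subtype.comp inK = algebraMap K E from RingHom.ext fun _ => rfl, map_zero]
      exact hμx
    have h1 := congrArg (σ j) h0
    rw [hom_eval₂, hx j, map_zero] at h1
    rwa [aeval_def, eval₂_map, show (algebraMap K E).comp (φ j) = (σ j).comp inK from RingHom.ext fun _ => rfl]
  by_contra hxL
  -- some coefficient `c` of `μ` lies outside `L` (else `μ` descends to `L[X]`)
  have hcoef : ∃ k, ((μ.coeff k : K) : E) ∉ L := by
    by_contra! hall
    have hlifts : μ ∈ Polynomial.lifts (algebraMap L K) := by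
      rw [lifts_iff_coeff_lifts]
      exact fun k => ⟨⟨_, hall k⟩, Subtype.ext rfl⟩
    obtain ⟨μ', hμ'map, -, hμ'mo⟩ := lifts_and_natDegree_eq_and_monic hlifts hμmo
    exact hxL ⟨μ', hμ'mo.ne_zero, by rw [← aeval_map_algebraMap K, hμ'map, hμx]⟩
  obtain ⟨k, hk⟩ := hcoef
  set c : E := ((μ.coeff k : K) : E)
  have hcK : c ∈ K := (μ.coeff k).2
  have hσc : ∀ j, σ j ⟨c, hKR c hcK⟩ = c := fun j => by
    have h1 := congrArg (fun r : K[X] => ((r.coeff k : K) : E)) (hμφ j)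
    simp only [coeff_map] at h1
    exact h1
  have hc0 : c ≠ 0 := fun h0 => hk (h0 ▸ L.zero_mem)
  -- write `c = p(y) / q(y)` with `p, q ∈ L[X]` coprime
  obtain ⟨p₀, q₀, hcpq⟩ := (IntermediateField.mem_adjoin_simple_iff (F := L) c).1 hcK
  have hyinj : Function.Injective (aeval y : L[X] →ₐ[L] E) := transcendental_iff_injective.mp hy
  have hq₀ : aeval y q₀ ≠ 0 := fun h0 => hc0 (by rw [hcpq, h0, div_zero])
  obtain ⟨p, q, hp₀, hq₀', hunit⟩ := extract_gcd p₀ q₀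
  set d := gcd p₀ q₀ with hd
  have hcop : IsCoprime p q := (gcd_isUnit_iff_isRelPrime.mp hunit).isCoprime
  have hd0 : aeval y d ≠ 0 ∧ aeval y q ≠ 0 := by rw [hq₀', map_mul] at hq₀; exact mul_ne_zero_iff.mp hq₀
  have hq : q ≠ 0 := fun h => hd0.2 (by rw [h, map_zero])
  have hcpq' : c = aeval y p / aeval y q := by rw [hcpq, hp₀, hq₀', map_mul, map_mul, mul_div_mul_left _ _ hd0.1]
  have hp0 : p ≠ 0 := fun h0 => hc0 (by rw [hcpq', h0, map_zero, zero_div])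
  -- how `σ j` acts on `r(y)` for `r ∈ L[X]`: `σ j (r(y)) = r^{γ j}(G j (y))`, `G j = u j • X + v j`
  let U : ι → L := fun j => ⟨u j, (hu j).1⟩
  let V : ι → L := fun j => ⟨v j, hv j⟩
  let G : ι → L[X] := fun j => C (U j) * X + C (V j)
  have hU0 : ∀ j, U j ≠ 0 := fun j h0 => (hu j).2 (congrArg Subtype.val h0)
  have hev : ∀ r : L[X], R.subtype (r.eval₂ (Subfield.inclusion hLR) ⟨y, hyR⟩) = aeval y r := fun r => by
    rw [hom_eval₂, show R.subtype.comp (Subfield.inclusion hLR) = algebraMap L E from RingHom.ext fun _ => rfl]; rfl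
  have hσev : ∀ j (r : L[X]), σ j (r.eval₂ (Subfield.inclusion hLR) ⟨y, hyR⟩) = aeval y ((r.map (γ j)).comp (G j)) :=
    fun j r => by
    rw [hom_eval₂, show (σ j).comp (Subfield.inclusion hLR) = (algebraMap L E).comp (γ j) from RingHom.ext fun _ => rfl,
      hσy j, aeval_comp, show aeval y (G j) = u j * y + v j by simp only [G, map_add, map_mul, aeval_C, aeval_X]; rfl,
      aeval_def, eval₂_map]
  have hcev : (⟨c, hKR c hcK⟩ : R) = p.eval₂ (Subfield.inclusion hLR) ⟨y, hyR⟩ / q.eval₂ (Subfield.inclusion hLR) ⟨y, hyR⟩ :=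
    R.subtype_injective (by rw [map_div₀, hev, hev, ← hcpq']; rfl)
  have hidE : ∀ j, c = aeval y ((p.map (γ j)).comp (G j)) / aeval y ((q.map (γ j)).comp (G j)) := fun j => by
    conv_lhs => rw [← hσc j, hcev, map_div₀, hσev, hσev]
  have hden : ∀ j, aeval y ((q.map (γ j)).comp (G j)) ≠ 0 := fun j => by
    rw [← hσev, _root_.map_ne_zero]
    exact fun h0 => hd0.2 (by rw [← hev q, h0, map_zero])
  have hid : ∀ j, p * (q.map (γ j)).comp (G j) = (p.map (γ j)).comp (G j) * q :=
    fun j => hyinj (by rw [map_mul, map_mul]; exact (div_eq_div_iff hd0.2 (hden j)).mp (hcpq'.symm.trans (hidE j)))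
  -- pigeonhole (`hfin`): infinitely many `j` twist `p` and `q` in the same way as some `j₀`
  have hγfin : ∀ a : L, (Set.range fun j => γ j a).Finite :=
    fun a => Set.Finite.of_finite_image (by rw [← Set.range_comp]; exact hfin a a.2) Subtype.val_injective.injOn
  let Φ : ι → L[X] × L[X] := fun j => (p.map (γ j), q.map (γ j))
  have hΦ : (Set.range Φ).Finite := ((affKill_finite_range_map p γ hγfin).prod (affKill_finite_range_map q γ hγfin)).subset
    (by rintro _ ⟨j, rfl⟩; exact ⟨⟨j, rfl⟩, ⟨j, rfl⟩⟩)
  obtain ⟨j₀, hJ⟩ : ∃ j₀, {j | Φ j = Φ j₀}.Infinite := by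
    by_contra! hall
    refine Set.infinite_univ (α := ι) ((hΦ.biUnion (t := fun P => {j | Φ j = P}) fun P hP => ?_).subset
      fun j _ => Set.mem_biUnion ⟨j, rfl⟩ rfl)
    obtain ⟨j₀, rfl⟩ := hP
    exact hall j₀
  -- the common twists `p̃ / q̃` give a rational function invariant under the affine maps `G j ∘ (G j₀)⁻¹`, `j ∈ J`
  let a : ι → L := fun j => U j * (U j₀)⁻¹
  let b : ι → L := fun j => V j - U j * V j₀ * (U j₀)⁻¹
  have hGinv : (G j₀).comp (C (U j₀)⁻¹ * (X - C (V j₀))) = X := by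
    simp only [G, add_comp, mul_comp, C_comp, X_comp, ← mul_assoc, ← C_mul, mul_inv_cancel₀ (hU0 j₀), C_1, one_mul,
      sub_add_cancel]
  have hGj : ∀ j, (G j).comp (C (U j₀)⁻¹ * (X - C (V j₀))) = C (a j) * X + C (b j) := fun j => by
    simp only [G, a, b, add_comp, mul_comp, C_comp, X_comp, map_sub, map_mul]; ring
  obtain ⟨κ, hκ⟩ := affKill_exists_C_mul_of_affine_invariant (p := p.map (γ j₀)) (q := q.map (γ j₀))
    ((Polynomial.map_ne_zero_iff (γ j₀).injective).mpr hq) (hcop.map (mapRingHom (γ j₀))) hJ a b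
    (fun j _ => mul_ne_zero (hU0 j) (inv_ne_zero (hU0 j₀)))
    (by
      rintro j - j' - hjj'
      obtain ⟨h1, h2⟩ := Prod.mk.injEq _ _ _ _ ▸ hjj'
      have hUU : U j = U j' := mul_right_cancel₀ (inv_ne_zero (hU0 j₀)) h1
      change V j - U j * V j₀ * (U j₀)⁻¹ = V j' - U j' * V j₀ * (U j₀)⁻¹ at h2
      rw [hUU, sub_left_inj] at h2
      exact hinj (Prod.ext (congrArg Subtype.val hUU) (congrArg Subtype.val h2)))
    (by
      intro j hj
      obtain ⟨hpj, hqj⟩ : p.map (γ j) = p.map (γ j₀) ∧ q.map (γ j) = q.map (γ j₀) := Prod.ext_iff.mp hj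
      have i1 := hid j
      rw [hpj, hqj] at i1
      have e1 : (q.map (γ j₀)).comp (G j) * (p.map (γ j₀)).comp (G j₀) = (p.map (γ j₀)).comp (G j) * (q.map (γ j₀)).comp (G j₀) :=
        mul_left_cancel₀ hp0 (by linear_combination (p.map (γ j₀)).comp (G j₀) * i1 - (p.map (γ j₀)).comp (G j) * hid j₀)
      have e2 := congrArg (fun r => r.comp (C (U j₀)⁻¹ * (X - C (V j₀)))) e1
      simp only [mul_comp, comp_assoc, hGinv, hGj, comp_X] at e2
      exact e2.symm)
  -- hence `c = σ j₀ c = κ ∈ L`, a contradiction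
  have hfinal : c = algebraMap L E κ := by
    rw [hidE j₀, hκ, mul_comp, C_comp, map_mul, aeval_C, mul_div_assoc, div_self (hden j₀), mul_one]
  exact hk (hfinal ▸ (κ : L).2)

end Summit.Schanuel.Schanuel.Theorems.RigidCore
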